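import Literature.NumberTheory.EllipticCurves.PointCountEulerCriterion
import HarnessLib
/-!
# BSD rank-≤1 residual cell, class X11b ∧ r = 1 ∧ p ≥ 5, SEMISTABLE in-window pairs: Frobenius
# point-count certificates `#Ẽ(𝔽_ℓ) = n` for the records of part 2 (kernel-decided data)

HONEST FRAMING (cell `b2b-bsdres-*`, verbatim): prove what is provable now; shrink each hard class
to its core with data; no claim beyond stated classes; COMBINATION classes deleted from PUBLISHED
theorems only, CONSTRUCTION-shaped remainder typed; this is not "finishing BSD". Class X11b stays
CONSTRUCTION-SHAPED; everything here is PER PAIR; no lane verdict is changed; no named fact.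

Unit `b2b-bsdres-x11c`, gen 9. Theorems only (no definition, no named fact, no `native_decide`), in the
exact shape of `Rank1ResidualX11RankOneFrobeniusCards{1,2}.lean` (the 85 non-semistable records) and
of the tree's `RationalIsogenyFrobeniusCertificates*.lean`: for each record of
`X11b/SemistableRecords2.lean` (Cremona label in the name, a-invariants literal) and ONE odd prime
`ℓ < 64` of good reduction (`ℓ ∤ Δ`, `ℓ ≠ p`; the smallest with `X² − a_ℓX + ℓ` root-free modulo the
record's `p`), the point count `#Ẽ(𝔽_ℓ) = n` of the reduction of the integer model, decided by the
kernel through `WeierstrassCurve.natCard_point_eq_one_add_card` and `card_sol_eq_sum_euler`. Consumer: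
`X11b/SemistableRecordsReduction.lean` (`a_ℓ = ℓ + 1 − n`, root-freeness decided there, `E[p]`
irreducible by Mazur 1978 Prop. 6.3 (1) via `IntModel.hasIrreducibleModPGaloisRep_of_intModel_of_noroot`).
Witnesses found by `code/b2b-bsdres-x11c/gen9/scan_sst58.py` (naive count); the kernel RE-VERIFIES
every count here.

References: B. Mazur, Invent. Math. 44 (1978) Prop. 6.3 (1) [Mazur1978]; K. Ireland, M. Rosen, GTM 84
(1990) §8.1 [IrelandRosen1990]; Cremona's tables [Cremona2006].
-/

namespace Summit.BirchSwinnertonDyer.Rank1Residual.X11b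

open Literature.NumberTheory.EllipticCurves

/-- `#Ẽ(𝔽_13) = 16` (`a_13 = -2`; `X² − a_13X + 13` root-free mod `p = 5`) for the semistable record `12110d1`. [folklore] -/
theorem card_s12110d1_13 :
    Nat.card (((⟨1, 0, 0, 79660, -5085808⟩ : WeierstrassCurve ℤ).map (Int.castRingHom (ZMod 13))).toAffine.Point) = 16 := by
  rw [@WeierstrassCurve.natCard_point_eq_one_add_card (ZMod 13) (@ZMod.instField 13 ⟨by norm_num⟩) _ _ _
    (by decide +kernel), @card_sol_eq_sum_euler (ZMod 13) (@ZMod.instField 13 ⟨by norm_num⟩) _ _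
    (by rw [ZMod.ringChar_zmod_n]; decide), ZMod.card]
  decide +kernel

/-- `#Ẽ(𝔽_29) = 38` (`a_29 = -8`; `X² − a_29X + 29` root-free mod `p = 5`) for the semistable record `12210q1`. [folklore] -/
theorem card_s12210q1_29 :
    Nat.card (((⟨1, 0, 1, -193, 13556⟩ : WeierstrassCurve ℤ).map (Int.castRingHom (ZMod 29))).toAffine.Point) = 38 := by
  rw [@WeierstrassCurve.natCard_point_eq_one_add_card (ZMod 29) (@ZMod.instField 29 ⟨by norm_num⟩) _ _ _
    (by decide +kernel), @card_sol_eq_sum_euler (ZMod 29) (@ZMod.instField 29 ⟨by norm_num⟩) _ _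
    (by rw [ZMod.ringChar_zmod_n]; decide), ZMod.card]
  decide +kernel

/-- `#Ẽ(𝔽_7) = 7` (`a_7 = 1`; `X² − a_7X + 7` root-free mod `p = 5`) for the semistable record `12630h1`. [folklore] -/
theorem card_s12630h1_7 :
    Nat.card (((⟨1, 1, 1, -20070, 979395⟩ : WeierstrassCurve ℤ).map (Int.castRingHom (ZMod 7))).toAffine.Point) = 7 := by
  rw [@WeierstrassCurve.natCard_point_eq_one_add_card (ZMod 7) (@ZMod.instField 7 ⟨by norm_num⟩) _ _ _
    (by decide +kernel), @card_sol_eq_sum_euler (ZMod 7) (@ZMod.instField 7 ⟨by norm_num⟩) _ _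
    (by rw [ZMod.ringChar_zmod_n]; decide), ZMod.card]
  decide +kernel

/-- `#Ẽ(𝔽_7) = 7` (`a_7 = 1`; `X² − a_7X + 7` root-free mod `p = 5`) for the semistable record `13035f1`. [folklore] -/
theorem card_s13035f1_7 :
    Nat.card (((⟨1, 0, 1, 432, -18917⟩ : WeierstrassCurve ℤ).map (Int.castRingHom (ZMod 7))).toAffine.Point) = 7 := by
  rw [@WeierstrassCurve.natCard_point_eq_one_add_card (ZMod 7) (@ZMod.instField 7 ⟨by norm_num⟩) _ _ _
    (by decide +kernel), @card_sol_eq_sum_euler (ZMod 7) (@ZMod.instField 7 ⟨by norm_num⟩) _ _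
    (by rw [ZMod.ringChar_zmod_n]; decide), ZMod.card]
  decide +kernel

/-- `#Ẽ(𝔽_5) = 8` (`a_5 = -2`; `X² − a_5X + 5` root-free mod `p = 7`) for the semistable record `13398bk1`. [folklore] -/
theorem card_s13398bk1_5 :
    Nat.card (((⟨1, 0, 0, 2271, 60489⟩ : WeierstrassCurve ℤ).map (Int.castRingHom (ZMod 5))).toAffine.Point) = 8 := by
  rw [@WeierstrassCurve.natCard_point_eq_one_add_card (ZMod 5) (@ZMod.instField 5 ⟨by norm_num⟩) _ _ _
    (by decide +kernel), @card_sol_eq_sum_euler (ZMod 5) (@ZMod.instField 5 ⟨by norm_num⟩) _ _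
    (by rw [ZMod.ringChar_zmod_n]; decide), ZMod.card]
  decide +kernel

/-- `#Ẽ(𝔽_7) = 8` (`a_7 = 0`; `X² − a_7X + 7` root-free mod `p = 5`) for the semistable record `13830h1`. [folklore] -/
theorem card_s13830h1_7 :
    Nat.card (((⟨1, 0, 0, -29725, 1969457⟩ : WeierstrassCurve ℤ).map (Int.castRingHom (ZMod 7))).toAffine.Point) = 8 := by
  rw [@WeierstrassCurve.natCard_point_eq_one_add_card (ZMod 7) (@ZMod.instField 7 ⟨by norm_num⟩) _ _ _
    (by decide +kernel), @card_sol_eq_sum_euler (ZMod 7) (@ZMod.instField 7 ⟨by norm_num⟩) _ _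
    (by rw [ZMod.ringChar_zmod_n]; decide), ZMod.card]
  decide +kernel

/-- `#Ẽ(𝔽_7) = 7` (`a_7 = 1`; `X² − a_7X + 7` root-free mod `p = 5`) for the semistable record `13970m1`. [folklore] -/
theorem card_s13970m1_7 :
    Nat.card (((⟨1, 1, 1, -97935, -12838763⟩ : WeierstrassCurve ℤ).map (Int.castRingHom (ZMod 7))).toAffine.Point) = 7 := by
  rw [@WeierstrassCurve.natCard_point_eq_one_add_card (ZMod 7) (@ZMod.instField 7 ⟨by norm_num⟩) _ _ _
    (by decide +kernel), @card_sol_eq_sum_euler (ZMod 7) (@ZMod.instField 7 ⟨by norm_num⟩) _ _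
    (by rw [ZMod.ringChar_zmod_n]; decide), ZMod.card]
  decide +kernel

/-- `#Ẽ(𝔽_7) = 8` (`a_7 = 0`; `X² − a_7X + 7` root-free mod `p = 5`) for the semistable record `14010e1`. [folklore] -/
theorem card_s14010e1_7 :
    Nat.card (((⟨1, 0, 1, -10698, -131972⟩ : WeierstrassCurve ℤ).map (Int.castRingHom (ZMod 7))).toAffine.Point) = 8 := by
  rw [@WeierstrassCurve.natCard_point_eq_one_add_card (ZMod 7) (@ZMod.instField 7 ⟨by norm_num⟩) _ _ _
    (by decide +kernel), @card_sol_eq_sum_euler (ZMod 7) (@ZMod.instField 7 ⟨by norm_num⟩) _ _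
    (by rw [ZMod.ringChar_zmod_n]; decide), ZMod.card]
  decide +kernel

/-- `#Ẽ(𝔽_7) = 12` (`a_7 = -4`; `X² − a_7X + 7` root-free mod `p = 5`) for the semistable record `14430ba1`. [folklore] -/
theorem card_s14430ba1_7 :
    Nat.card (((⟨1, 1, 1, -68160, 6820065⟩ : WeierstrassCurve ℤ).map (Int.castRingHom (ZMod 7))).toAffine.Point) = 12 := by
  rw [@WeierstrassCurve.natCard_point_eq_one_add_card (ZMod 7) (@ZMod.instField 7 ⟨by norm_num⟩) _ _ _
    (by decide +kernel), @card_sol_eq_sum_euler (ZMod 7) (@ZMod.instField 7 ⟨by norm_num⟩) _ _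
    (by rw [ZMod.ringChar_zmod_n]; decide), ZMod.card]
  decide +kernel

/-- `#Ẽ(𝔽_7) = 4` (`a_7 = 4`; `X² − a_7X + 7` root-free mod `p = 5`) for the semistable record `14835f1`. [folklore] -/
theorem card_s14835f1_7 :
    Nat.card (((⟨1, 0, 1, -32405093, 70998879431⟩ : WeierstrassCurve ℤ).map (Int.castRingHom (ZMod 7))).toAffine.Point) = 4 := by
  rw [@WeierstrassCurve.natCard_point_eq_one_add_card (ZMod 7) (@ZMod.instField 7 ⟨by norm_num⟩) _ _ _
    (by decide +kernel), @card_sol_eq_sum_euler (ZMod 7) (@ZMod.instField 7 ⟨by norm_num⟩) _ _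
    (by rw [ZMod.ringChar_zmod_n]; decide), ZMod.card]
  decide +kernel

/-- `#Ẽ(𝔽_17) = 22` (`a_17 = -4`; `X² − a_17X + 17` root-free mod `p = 5`) for the semistable record `15015k1`. [folklore] -/
theorem card_s15015k1_17 :
    Nat.card (((⟨0, 1, 1, -71476861, -232616659709⟩ : WeierstrassCurve ℤ).map (Int.castRingHom (ZMod 17))).toAffine.Point) = 22 := by
  rw [@WeierstrassCurve.natCard_point_eq_one_add_card (ZMod 17) (@ZMod.instField 17 ⟨by norm_num⟩) _ _ _
    (by decide +kernel), @card_sol_eq_sum_euler (ZMod 17) (@ZMod.instField 17 ⟨by norm_num⟩) _ _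
    (by rw [ZMod.ringChar_zmod_n]; decide), ZMod.card]
  decide +kernel

/-- `#Ẽ(𝔽_3) = 2` (`a_3 = 2`; `X² − a_3X + 3` root-free mod `p = 5`) for the semistable record `16030c1`. [folklore] -/
theorem card_s16030c1_3 :
    Nat.card (((⟨1, 1, 0, -59727, -1297051⟩ : WeierstrassCurve ℤ).map (Int.castRingHom (ZMod 3))).toAffine.Point) = 2 := by
  rw [@WeierstrassCurve.natCard_point_eq_one_add_card (ZMod 3) (@ZMod.instField 3 ⟨by norm_num⟩) _ _ _
    (by decide +kernel), @card_sol_eq_sum_euler (ZMod 3) (@ZMod.instField 3 ⟨by norm_num⟩) _ _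
    (by rw [ZMod.ringChar_zmod_n]; decide), ZMod.card]
  decide +kernel

/-- `#Ẽ(𝔽_5) = 2` (`a_5 = 4`; `X² − a_5X + 5` root-free mod `p = 11`) for the semistable record `16082a1`. [folklore] -/
theorem card_s16082a1_5 :
    Nat.card (((⟨1, 1, 0, -812952198, 16186005547540⟩ : WeierstrassCurve ℤ).map (Int.castRingHom (ZMod 5))).toAffine.Point) = 2 := by
  rw [@WeierstrassCurve.natCard_point_eq_one_add_card (ZMod 5) (@ZMod.instField 5 ⟨by norm_num⟩) _ _ _
    (by decide +kernel), @card_sol_eq_sum_euler (ZMod 5) (@ZMod.instField 5 ⟨by norm_num⟩) _ _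
    (by rw [ZMod.ringChar_zmod_n]; decide), ZMod.card]
  decide +kernel

/-- `#Ẽ(𝔽_3) = 2` (`a_3 = 2`; `X² − a_3X + 3` root-free mod `p = 5`) for the semistable record `16390q1`. [folklore] -/
theorem card_s16390q1_3 :
    Nat.card (((⟨1, 1, 1, -185742041, 1071116403463⟩ : WeierstrassCurve ℤ).map (Int.castRingHom (ZMod 3))).toAffine.Point) = 2 := by
  rw [@WeierstrassCurve.natCard_point_eq_one_add_card (ZMod 3) (@ZMod.instField 3 ⟨by norm_num⟩) _ _ _
    (by decide +kernel), @card_sol_eq_sum_euler (ZMod 3) (@ZMod.instField 3 ⟨by norm_num⟩) _ _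
    (by rw [ZMod.ringChar_zmod_n]; decide), ZMod.card]
  decide +kernel

/-- `#Ẽ(𝔽_3) = 3` (`a_3 = 1`; `X² − a_3X + 3` root-free mod `p = 7`) for the semistable record `16730i1`. [folklore] -/
theorem card_s16730i1_3 :
    Nat.card (((⟨1, 0, 0, -54110, -4915900⟩ : WeierstrassCurve ℤ).map (Int.castRingHom (ZMod 3))).toAffine.Point) = 3 := by
  rw [@WeierstrassCurve.natCard_point_eq_one_add_card (ZMod 3) (@ZMod.instField 3 ⟨by norm_num⟩) _ _ _
    (by decide +kernel), @card_sol_eq_sum_euler (ZMod 3) (@ZMod.instField 3 ⟨by norm_num⟩) _ _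
    (by rw [ZMod.ringChar_zmod_n]; decide), ZMod.card]
  decide +kernel

/-- `#Ẽ(𝔽_3) = 7` (`a_3 = -3`; `X² − a_3X + 3` root-free mod `p = 5`) for the semistable record `16910c1`. [folklore] -/
theorem card_s16910c1_3 :
    Nat.card (((⟨1, -1, 0, 12905, 567325⟩ : WeierstrassCurve ℤ).map (Int.castRingHom (ZMod 3))).toAffine.Point) = 7 := by
  rw [@WeierstrassCurve.natCard_point_eq_one_add_card (ZMod 3) (@ZMod.instField 3 ⟨by norm_num⟩) _ _ _
    (by decide +kernel), @card_sol_eq_sum_euler (ZMod 3) (@ZMod.instField 3 ⟨by norm_num⟩) _ _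
    (by rw [ZMod.ringChar_zmod_n]; decide), ZMod.card]
  decide +kernel

/-- `#Ẽ(𝔽_23) = 21` (`a_23 = 3`; `X² − a_23X + 23` root-free mod `p = 5`) for the semistable record `17130s1`. [folklore] -/
theorem card_s17130s1_23 :
    Nat.card (((⟨1, 0, 0, 81210, -18207900⟩ : WeierstrassCurve ℤ).map (Int.castRingHom (ZMod 23))).toAffine.Point) = 21 := by
  rw [@WeierstrassCurve.natCard_point_eq_one_add_card (ZMod 23) (@ZMod.instField 23 ⟨by norm_num⟩) _ _ _
    (by decide +kernel), @card_sol_eq_sum_euler (ZMod 23) (@ZMod.instField 23 ⟨by norm_num⟩) _ _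
    (by rw [ZMod.ringChar_zmod_n]; decide), ZMod.card]
  decide +kernel

/-- `#Ẽ(𝔽_13) = 12` (`a_13 = 2`; `X² − a_13X + 13` root-free mod `p = 5`) for the semistable record `17170m1`. [folklore] -/
theorem card_s17170m1_13 :
    Nat.card (((⟨1, 1, 1, -9315, -350303⟩ : WeierstrassCurve ℤ).map (Int.castRingHom (ZMod 13))).toAffine.Point) = 12 := by
  rw [@WeierstrassCurve.natCard_point_eq_one_add_card (ZMod 13) (@ZMod.instField 13 ⟨by norm_num⟩) _ _ _
    (by decide +kernel), @card_sol_eq_sum_euler (ZMod 13) (@ZMod.instField 13 ⟨by norm_num⟩) _ _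
    (by rw [ZMod.ringChar_zmod_n]; decide), ZMod.card]
  decide +kernel

/-- `#Ẽ(𝔽_7) = 13` (`a_7 = -5`; `X² − a_7X + 7` root-free mod `p = 5`) for the semistable record `17170p1`. [folklore] -/
theorem card_s17170p1_7 :
    Nat.card (((⟨1, 1, 1, -505, 4167⟩ : WeierstrassCurve ℤ).map (Int.castRingHom (ZMod 7))).toAffine.Point) = 13 := by
  rw [@WeierstrassCurve.natCard_point_eq_one_add_card (ZMod 7) (@ZMod.instField 7 ⟨by norm_num⟩) _ _ _
    (by decide +kernel), @card_sol_eq_sum_euler (ZMod 7) (@ZMod.instField 7 ⟨by norm_num⟩) _ _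
    (by rw [ZMod.ringChar_zmod_n]; decide), ZMod.card]
  decide +kernel

/-- `#Ẽ(𝔽_3) = 6` (`a_3 = -2`; `X² − a_3X + 3` root-free mod `p = 5`) for the semistable record `17390g1`. [folklore] -/
theorem card_s17390g1_3 :
    Nat.card (((⟨1, 0, 0, -355, 5025⟩ : WeierstrassCurve ℤ).map (Int.castRingHom (ZMod 3))).toAffine.Point) = 6 := by
  rw [@WeierstrassCurve.natCard_point_eq_one_add_card (ZMod 3) (@ZMod.instField 3 ⟨by norm_num⟩) _ _ _
    (by decide +kernel), @card_sol_eq_sum_euler (ZMod 3) (@ZMod.instField 3 ⟨by norm_num⟩) _ _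
    (by rw [ZMod.ringChar_zmod_n]; decide), ZMod.card]
  decide +kernel

/-- `#Ẽ(𝔽_11) = 12` (`a_11 = 0`; `X² − a_11X + 11` root-free mod `p = 7`) for the semistable record `18165j1`. [folklore] -/
theorem card_s18165j1_11 :
    Nat.card (((⟨1, 0, 1, 7102917, 12559254643⟩ : WeierstrassCurve ℤ).map (Int.castRingHom (ZMod 11))).toAffine.Point) = 12 := by
  rw [@WeierstrassCurve.natCard_point_eq_one_add_card (ZMod 11) (@ZMod.instField 11 ⟨by norm_num⟩) _ _ _
    (by decide +kernel), @card_sol_eq_sum_euler (ZMod 11) (@ZMod.instField 11 ⟨by norm_num⟩) _ _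
    (by rw [ZMod.ringChar_zmod_n]; decide), ZMod.card]
  decide +kernel

/-- `#Ẽ(𝔽_5) = 10` (`a_5 = -4`; `X² − a_5X + 5` root-free mod `p = 7`) for the semistable record `18354c1`. [folklore] -/
theorem card_s18354c1_5 :
    Nat.card (((⟨1, 1, 0, -737, 49845⟩ : WeierstrassCurve ℤ).map (Int.castRingHom (ZMod 5))).toAffine.Point) = 10 := by
  rw [@WeierstrassCurve.natCard_point_eq_one_add_card (ZMod 5) (@ZMod.instField 5 ⟨by norm_num⟩) _ _ _
    (by decide +kernel), @card_sol_eq_sum_euler (ZMod 5) (@ZMod.instField 5 ⟨by norm_num⟩) _ _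
    (by rw [ZMod.ringChar_zmod_n]; decide), ZMod.card]
  decide +kernel

/-- `#Ẽ(𝔽_5) = 3` (`a_5 = 3`; `X² − a_5X + 5` root-free mod `p = 7`) for the semistable record `18354r1`. [folklore] -/
theorem card_s18354r1_5 :
    Nat.card (((⟨1, 1, 1, -4787404, 4362093389⟩ : WeierstrassCurve ℤ).map (Int.castRingHom (ZMod 5))).toAffine.Point) = 3 := by
  rw [@WeierstrassCurve.natCard_point_eq_one_add_card (ZMod 5) (@ZMod.instField 5 ⟨by norm_num⟩) _ _ _
    (by decide +kernel), @card_sol_eq_sum_euler (ZMod 5) (@ZMod.instField 5 ⟨by norm_num⟩) _ _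
    (by rw [ZMod.ringChar_zmod_n]; decide), ZMod.card]
  decide +kernel

/-- `#Ẽ(𝔽_3) = 6` (`a_3 = -2`; `X² − a_3X + 3` root-free mod `p = 5`) for the semistable record `18530j1`. [folklore] -/
theorem card_s18530j1_3 :
    Nat.card (((⟨1, 0, 0, -6915, 220225⟩ : WeierstrassCurve ℤ).map (Int.castRingHom (ZMod 3))).toAffine.Point) = 6 := by
  rw [@WeierstrassCurve.natCard_point_eq_one_add_card (ZMod 3) (@ZMod.instField 3 ⟨by norm_num⟩) _ _ _
    (by decide +kernel), @card_sol_eq_sum_euler (ZMod 3) (@ZMod.instField 3 ⟨by norm_num⟩) _ _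
    (by rw [ZMod.ringChar_zmod_n]; decide), ZMod.card]
  decide +kernel

/-- `#Ẽ(𝔽_7) = 8` (`a_7 = 0`; `X² − a_7X + 7` root-free mod `p = 5`) for the semistable record `19065i1`. [folklore] -/
theorem card_s19065i1_7 :
    Nat.card (((⟨0, 1, 1, -1927751, 549763655⟩ : WeierstrassCurve ℤ).map (Int.castRingHom (ZMod 7))).toAffine.Point) = 8 := by
  rw [@WeierstrassCurve.natCard_point_eq_one_add_card (ZMod 7) (@ZMod.instField 7 ⟨by norm_num⟩) _ _ _
    (by decide +kernel), @card_sol_eq_sum_euler (ZMod 7) (@ZMod.instField 7 ⟨by norm_num⟩) _ _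
    (by rw [ZMod.ringChar_zmod_n]; decide), ZMod.card]
  decide +kernel

/-- `#Ẽ(𝔽_7) = 13` (`a_7 = -5`; `X² − a_7X + 7` root-free mod `p = 5`) for the semistable record `19090e1`. [folklore] -/
theorem card_s19090e1_7 :
    Nat.card (((⟨1, 1, 0, -23152238, 42829511092⟩ : WeierstrassCurve ℤ).map (Int.castRingHom (ZMod 7))).toAffine.Point) = 13 := by
  rw [@WeierstrassCurve.natCard_point_eq_one_add_card (ZMod 7) (@ZMod.instField 7 ⟨by norm_num⟩) _ _ _
    (by decide +kernel), @card_sol_eq_sum_euler (ZMod 7) (@ZMod.instField 7 ⟨by norm_num⟩) _ _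
    (by rw [ZMod.ringChar_zmod_n]; decide), ZMod.card]
  decide +kernel

/-- `#Ẽ(𝔽_11) = 8` (`a_11 = 4`; `X² − a_11X + 11` root-free mod `p = 5`) for the semistable record `19230h1`. [folklore] -/
theorem card_s19230h1_11 :
    Nat.card (((⟨1, 0, 0, 25635, 1026225⟩ : WeierstrassCurve ℤ).map (Int.castRingHom (ZMod 11))).toAffine.Point) = 8 := by
  rw [@WeierstrassCurve.natCard_point_eq_one_add_card (ZMod 11) (@ZMod.instField 11 ⟨by norm_num⟩) _ _ _
    (by decide +kernel), @card_sol_eq_sum_euler (ZMod 11) (@ZMod.instField 11 ⟨by norm_num⟩) _ _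
    (by rw [ZMod.ringChar_zmod_n]; decide), ZMod.card]
  decide +kernel

/-- `#Ẽ(𝔽_11) = 16` (`a_11 = -4`; `X² − a_11X + 11` root-free mod `p = 5`) for the semistable record `19290k1`. [folklore] -/
theorem card_s19290k1_11 :
    Nat.card (((⟨1, 0, 1, -49423, -23174494⟩ : WeierstrassCurve ℤ).map (Int.castRingHom (ZMod 11))).toAffine.Point) = 16 := by
  rw [@WeierstrassCurve.natCard_point_eq_one_add_card (ZMod 11) (@ZMod.instField 11 ⟨by norm_num⟩) _ _ _
    (by decide +kernel), @card_sol_eq_sum_euler (ZMod 11) (@ZMod.instField 11 ⟨by norm_num⟩) _ _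
    (by rw [ZMod.ringChar_zmod_n]; decide), ZMod.card]
  decide +kernel

/-- `#Ẽ(𝔽_3) = 4` (`a_3 = 0`; `X² − a_3X + 3` root-free mod `p = 5`) for the semistable record `19565d1`. [folklore] -/
theorem card_s19565d1_3 :
    Nat.card (((⟨0, 0, 1, -10058, 384233⟩ : WeierstrassCurve ℤ).map (Int.castRingHom (ZMod 3))).toAffine.Point) = 4 := by
  rw [@WeierstrassCurve.natCard_point_eq_one_add_card (ZMod 3) (@ZMod.instField 3 ⟨by norm_num⟩) _ _ _
    (by decide +kernel), @card_sol_eq_sum_euler (ZMod 3) (@ZMod.instField 3 ⟨by norm_num⟩) _ _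
    (by rw [ZMod.ringChar_zmod_n]; decide), ZMod.card]
  decide +kernel

end Summit.BirchSwinnertonDyer.Rank1Residual.X11b
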